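import Literature.AnabelianGeometry.SemiGraphs.PSCShadowGraphicPackages
import Literature.AnabelianGeometry.SemiGraphs.PSCThm16iiAssemblyPrimeProofs
import Literature.AnabelianGeometry.SemiGraphs.PSCCoveringMapAlongTransfer
import Literature.AnabelianGeometry.SemiGraphs.PSCProLCuspidalProofs
import Literature.AnabelianGeometry.SemiGraphs.PSCCommonPrimeProofs
import Literature.AnabelianGeometry.SemiGraphs.PSCCommonPrimeGraphicProofs
import HarnessLib

/-!
# [CombGC] Theorem 1.6 (ii) for GENERAL `Σ`: "we may assume that `Σ = {l}`", by shadow graphicity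

Mochizuki, *A combinatorial version of the Grothendieck conjecture*, Tohoku Math. J. **59** (2007)
[CombGC], Theorem 1.6 (ii), author's manuscript p. 13 ("`α` is graphic if and only if it is
graphically filtration-preserving"), with the reduction of the proof of Thm. 1.6, p. 13 l.−8…−4:
"Since the [verticial, edge-like] subgroups may be recovered as the stabilizers of [vertices, edges] of
finite étale coverings … we may assume that `Σ = {l}`".  Row T16-L04b («general-`Σ` (ii)») of the
abc-iut cell's sub-DAG for Thm. 1.6 (`plan/L3/SUBDAG-CombGC-Thm16.md`; booked as the writer's residual
by abc-iut-w4-d052, whose assembly `PSCThm16iiAssemblyProofs` / its F-1938′ migration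
`PSCThm16iiAssemblyPrimeProofs` is the case `Σ_G = Σ_H = {l}`).

THE SHADOW-GRAPHICITY ROUTE (abc-iut-w5-d174).  Let `G`, `H` be of `Ω`-type on profinite groups with a
common prime `l ∈ Σ_G ∩ Σ_H`, and `α : Π_G ≅ Π_H` graphically filtration-preserving.  At EVERY open normal
level `U ⊴ Π_G` (`U' := α U`): presentations `g`, `g'` of the maximal pro-`l` quotients of `U`, `U'`
(abc-iut-L3-t4's `exists_isMaxProSigmaQuotient`; their kernels correspond under `α|_U` by
`IsMaxProSigmaQuotient.map_ker_eq`, whence `ᾱ_U` over `α|_U`, abc-iut-w5-d188's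
`exists_over_of_ker_map_eq`); the SHADOWS `D = (G_U)^{(l)}`, `D' = (H_{U'})^{(l)}`
(`restrictBD` ⋙ `mapAlong`) are of `Ω`-type (`RestrictBDOfPSCTypeHolds`, `MapAlongProLOfPSCTypeHolds`),
profinite, with `Σ = {l}`, and `ᾱ_U` is graphically filtration-preserving (abc-iut-L3-t4's transfer
`IsGraphicallyFiltrationPreserving.mapAlong`); hence — THE `Σ = {l}` CASE OF THM. 1.6 (ii), kernel
`isGraphic_of_isGraphicallyFiltrationPreserving_holds'` — `ᾱ_U` is GRAPHIC between the shadows; pulling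
the graph isomorphism back along `g'` (`PSCShadowGraphicPackages.lean`) gives the level-`U` vertex and
edge packages (`α`-graphic modulo `(ker g')↑`, separation from Prop. 1.2 (i) for `D'`), and
abc-iut-w5-d188's all-level descents (`isGroupTheoreticallyVerticial_of_graphic_mod`,
`isGroupTheoreticallyEdgeLike_of_graphic_mod`) make `α` group-theoretically verticial and edge-like,
i.e. GRAPHIC by Prop. 1.5 (ii) (`GraphicIffEdgeLikeVerticialHolds`).

* `normal_map_subtype_ker_of_isMaxProSigmaQuotient` — `(ker g)↑ ⊴ Π` for a presentation `g` of the
  maximal pro-`S` quotient of an open normal `U` (the kernel is topologically characteristic);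
* `shadow_packages_at_level` — the two level-`U` packages, for every open normal `U`;
* `isGraphic_of_isGraphicallyFiltrationPreserving_generalSigma_holds'` — **Thm. 1.6 (ii) ⇐ for general
  `Σ`** (common prime `l`), every input an origin statement BY NAME: the twelve of the `Σ = {l}` assembly
  (with the corrected [IUTchI] Rmk. 1.2.3 (iv) input `UnrVerticialCharacterizationHolds'`) plus
  `MapAlongProLOfPSCTypeHolds`;
* `graphicIffFiltrationPreserving_generalSigma_holds_of_inputs'` — the typed statement
  `GraphicIffGraphicallyFiltrationPreserving` (⇒ is abc-iut-L5-t6's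
  `isGraphicallyFiltrationPreserving_of_isGraphic`);
* `graphicIffFiltrationPreservingHolds_of_inputs'` — **the printed statement over the origin,
  `GraphicIffFiltrationPreservingHolds Ω` (abc-iut-L3-t4's typed row F-0444), for EVERY `Σ`**: the common
  prime is automatic for nontrivial profinite `Π_G ≅ Π_H` (abc-iut-w5-d183's
  `exists_mem_sigma_inter_of_continuousMulEquiv`); nontriviality of `Π` displayed like profiniteness;
* `graphicIffFiltrationPreservingHolds_of_inputs''` (appended) — the same with the nontriviality
  DISCHARGED (abc-iut-w5-d183's `graphicIffFiltrationPreserving_holds_of_commonPrimeVersion`).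

Proof-only (0 defs); a FACT row is an assumption label; nothing here takes a side on [IUTchIII]
Cor. 3.12. [cite: MochizukiCombGC2007, Thm 1.6(ii) p.13] [cite: MochizukiCombGC2007, Thm 1.6(i) p.13]
[cite: MochizukiCombGC2007, Thm 1.6(ii) p.14]
-/

noncomputable section

namespace Literature.AnabelianGeometry.SemiGraphs

namespace PSCDatum

open scoped Pointwise
open PSCCovering

universe u

/-! ### `(ker g)↑` is normal for a presentation of the maximal pro-`S` quotient of an open normal `U` -/

section KerNormal

variable {P : Type u} [Group P] [TopologicalSpace P] [IsTopologicalGroup P]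
variable {U : Subgroup P} [U.Normal]
variable {Q : Type u} [Group Q] [TopologicalSpace Q] [IsTopologicalGroup Q] [CompactSpace Q]
  [TotallyDisconnectedSpace Q]
variable {S : Set ℕ} {g : U →* Q}

/-- **`(ker g)↑ ⊴ Π`** for `U ⊴ Π` and `g : U ↠ Q` a presentation of the maximal pro-`S` quotient of `U`
(`Q` profinite): conjugation by `p ∈ Π` is a topological automorphism of `U`, and the kernel of `g` is
topologically characteristic in `U` (abc-iut-L3-t4's `IsMaxProSigmaQuotient.map_ker_eq`).
[cite: MochizukiCombGC2007, Thm 1.6(i) p.13] -/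
theorem normal_map_subtype_ker_of_isMaxProSigmaQuotient (hg : IsMaxProSigmaQuotient S g) :
    (g.ker.map U.subtype).Normal := by
  refine ⟨fun k hk p => ?_⟩
  obtain ⟨u, hu, rfl⟩ := hk
  -- conjugation by `p` as a topological automorphism of `U`
  have hc : Continuous (MulAut.conjNormal p : U ≃* U) := by
    apply continuous_induced_rng.mpr
    have : Subtype.val ∘ (MulAut.conjNormal p : U ≃* U) = fun u : U => p * (u : P) * p⁻¹ := by
      funext u; exact MulAut.conjNormal_apply p u
    rw [this]
    exact (continuous_const.mul continuous_subtype_val).mul continuous_const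
  have hc' : Continuous (MulAut.conjNormal p : U ≃* U).symm := by
    apply continuous_induced_rng.mpr
    have : Subtype.val ∘ (MulAut.conjNormal p : U ≃* U).symm = fun u : U => p⁻¹ * (u : P) * p := by
      funext u; exact MulAut.conjNormal_symm_apply p u
    rw [this]
    exact (continuous_const.mul continuous_subtype_val).mul continuous_const
  let θU : U ≃ₜ* U :=
    { (MulAut.conjNormal p : U ≃* U) with
      continuous_toFun := hc
      continuous_invFun := hc' }
  have hθU : ((θU u : U) : P) = p * u * p⁻¹ := MulAut.conjNormal_apply p u
  have hker : g.ker.map θU.toMulEquiv.toMonoidHom = g.ker := hg.map_ker_eq hg θU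
  have hmem : θU u ∈ g.ker := by
    rw [← hker]
    exact ⟨u, hu, rfl⟩
  rw [Subgroup.coe_subtype, ← hθU]
  exact ⟨θU u, hmem, rfl⟩

end KerNormal

/-! ### The level step: both packages at every open normal level, from the `Σ = {l}` theorem for the shadows -/

section Level

variable (Ω : PSCOrigin.{u})
variable {P : Type u} [Group P] [TopologicalSpace P] [IsTopologicalGroup P] [CompactSpace P]
  [TotallyDisconnectedSpace P]
variable {P' : Type u} [Group P'] [TopologicalSpace P'] [IsTopologicalGroup P'] [CompactSpace P']
  [TotallyDisconnectedSpace P']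
variable {G : PSCDatum P} {H : PSCDatum P'} {α : P ≃ₜ* P'}

/-- **The two level-`U` packages from the `Σ = {l}` theorem applied to the pro-`l` shadows** (every open
normal `U ⊴ Π_G`; `U' := α U`): a bijection of the level vertex [edge] sets which is `α`-graphic modulo
`(ker g')↑` with separation, `g'` a presentation of the maximal pro-`l` quotient of `U'`.  Inputs BY NAME:
the twelve origin statements of the `Σ = {l}` assembly (with `UnrVerticialCharacterizationHolds'`),
`MapAlongProLOfPSCTypeHolds`, coverings of `Ω`-type (`hbd`, `hbd'`), a common prime `l`, and `α`
graphically filtration-preserving. [cite: MochizukiCombGC2007, Thm 1.6(ii) p.14] -/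
theorem shadow_packages_at_level
    (hprof : ∀ ⦃R : Type u⦄ [Group R] [TopologicalSpace R] [IsTopologicalGroup R] (K : PSCDatum R),
      Ω.IsOfPSCType K → CompactSpace R ∧ TotallyDisconnectedSpace R)
    (hrank : RankStatementsHold Ω) (hcuspΩ : CuspidalEdgeLikeCharacterizationHolds Ω)
    (hnodal : NodalEdgeLikeCharacterizationHolds Ω) (hcpt : CompactifyOfPSCTypeHolds Ω)
    (hres : RestrictBDOfPSCTypeHolds Ω) (hcover : SturdyCoverHolds Ω)
    (hopen : OpenInterDeterminesComponentHolds Ω) (hCT : CommensurableTerminalityHolds Ω)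
    (hP15 : GraphicIffEdgeLikeVerticialHolds Ω) (hunr : UnrVerticialCharacterizationHolds' Ω)
    (hrankv : UnrVertAbOfRankHolds Ω) (hconn : VertCountLeNodeCountSuccHolds Ω)
    (hmapΩ : MapAlongProLOfPSCTypeHolds Ω)
    (bd : G.BranchData) (bd' : H.BranchData)
    (hbd : ∀ (U : Subgroup P) [U.FiniteIndex] (hU : IsOpen (U : Set P)),
      Ω.IsOfPSCType (G.restrictBD U hU bd))
    (hbd' : ∀ (U' : Subgroup P') [U'.FiniteIndex] (hU' : IsOpen (U' : Set P')),
      Ω.IsOfPSCType (H.restrictBD U' hU' bd'))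
    {l : ℕ} (hl : l ∈ G.Sigma) (hl' : l ∈ H.Sigma) (hα : G.IsGraphicallyFiltrationPreserving H α)
    (U : Subgroup P) (hUn : U.Normal) (hUo : IsOpen (U : Set P)) :
    (∃ (K' : Subgroup P') (_ : K'.Normal)
      (e : (Σ v, DoubleCoset.Quotient (U : Set P) (G.vertGp v : Set P)) ≃
        (Σ w, DoubleCoset.Quotient ((U.map α.toMulEquiv.toMonoidHom : Subgroup P') : Set P')
          (H.vertGp w : Set P'))),
      (∀ (v : G.graph.V) (x : P) (w : H.graph.V) (y : P'),
        e ⟨v, DoubleCoset.mk U (G.vertGp v) x⟩ =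
            ⟨w, DoubleCoset.mk (U.map α.toMulEquiv.toMonoidHom) (H.vertGp w) y⟩ →
          ∃ u' ∈ U.map α.toMulEquiv.toMonoidHom,
            (U ⊓ ConjAct.toConjAct x • G.vertGp v).map α.toMulEquiv.toMonoidHom ⊔ K' =
              ConjAct.toConjAct u' •
                ((U.map α.toMulEquiv.toMonoidHom ⊓ ConjAct.toConjAct y • H.vertGp w) ⊔ K')) ∧
      (∀ (w₁ : H.graph.V) (y₁ : P') (w₂ : H.graph.V) (y₂ : P'),
        (∃ u' ∈ U.map α.toMulEquiv.toMonoidHom,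
            (U.map α.toMulEquiv.toMonoidHom ⊓ ConjAct.toConjAct y₁ • H.vertGp w₁) ⊔ K' =
              ConjAct.toConjAct u' •
                ((U.map α.toMulEquiv.toMonoidHom ⊓ ConjAct.toConjAct y₂ • H.vertGp w₂) ⊔ K')) →
          (⟨w₁, DoubleCoset.mk (U.map α.toMulEquiv.toMonoidHom) (H.vertGp w₁) y₁⟩ :
              Σ w, DoubleCoset.Quotient ((U.map α.toMulEquiv.toMonoidHom : Subgroup P') : Set P')
                (H.vertGp w : Set P')) =
            ⟨w₂, DoubleCoset.mk (U.map α.toMulEquiv.toMonoidHom) (H.vertGp w₂) y₂⟩)) ∧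
    (∃ (K' : Subgroup P') (_ : K'.Normal)
      (e : (Σ c, DoubleCoset.Quotient (U : Set P) (G.edgeGp c : Set P)) ≃
        (Σ c', DoubleCoset.Quotient ((U.map α.toMulEquiv.toMonoidHom : Subgroup P') : Set P')
          (H.edgeGp c' : Set P'))),
      (∀ (c : G.graph.N ⊕ G.graph.C) (x : P) (c' : H.graph.N ⊕ H.graph.C) (y : P'),
        e ⟨c, DoubleCoset.mk U (G.edgeGp c) x⟩ =
            ⟨c', DoubleCoset.mk (U.map α.toMulEquiv.toMonoidHom) (H.edgeGp c') y⟩ →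
          ∃ u' ∈ U.map α.toMulEquiv.toMonoidHom,
            (U ⊓ ConjAct.toConjAct x • G.edgeGp c).map α.toMulEquiv.toMonoidHom ⊔ K' =
              ConjAct.toConjAct u' •
                ((U.map α.toMulEquiv.toMonoidHom ⊓ ConjAct.toConjAct y • H.edgeGp c') ⊔ K')) ∧
      (∀ (c₁ : H.graph.N ⊕ H.graph.C) (y₁ : P') (c₂ : H.graph.N ⊕ H.graph.C) (y₂ : P'),
        (∃ u' ∈ U.map α.toMulEquiv.toMonoidHom,
            (U.map α.toMulEquiv.toMonoidHom ⊓ ConjAct.toConjAct y₁ • H.edgeGp c₁) ⊔ K' =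
              ConjAct.toConjAct u' •
                ((U.map α.toMulEquiv.toMonoidHom ⊓ ConjAct.toConjAct y₂ • H.edgeGp c₂) ⊔ K')) →
          (⟨c₁, DoubleCoset.mk (U.map α.toMulEquiv.toMonoidHom) (H.edgeGp c₁) y₁⟩ :
              Σ c', DoubleCoset.Quotient ((U.map α.toMulEquiv.toMonoidHom : Subgroup P') : Set P')
                (H.edgeGp c' : Set P')) =
            ⟨c₂, DoubleCoset.mk (U.map α.toMulEquiv.toMonoidHom) (H.edgeGp c₂) y₂⟩)) := by
  -- the two levels `U`, `U' = α(U)` as profinite groups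
  haveI := hUn
  haveI : Finite (P ⧸ U) := Subgroup.quotient_finite_of_isOpen U hUo
  haveI : U.FiniteIndex := Subgroup.finiteIndex_of_finite_quotient
  haveI : CompactSpace U := isCompact_iff_compactSpace.mp (Subgroup.isClosed_of_isOpen U hUo).isCompact
  obtain ⟨hU'n, hU'o⟩ := level_map α hUn hUo
  haveI := hU'n
  haveI : Finite (P' ⧸ U.map α.toMulEquiv.toMonoidHom) := Subgroup.quotient_finite_of_isOpen _ hU'o
  haveI : (U.map α.toMulEquiv.toMonoidHom).FiniteIndex := Subgroup.finiteIndex_of_finite_quotient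
  haveI : CompactSpace (U.map α.toMulEquiv.toMonoidHom) :=
    isCompact_iff_compactSpace.mp (Subgroup.isClosed_of_isOpen _ hU'o).isCompact
  -- presentations of the maximal pro-`l` quotients of `U` and `U'`
  obtain ⟨K, hKn, hKc, hg⟩ := exists_isMaxProSigmaQuotient ({l} : Set ℕ) (P := U)
  obtain ⟨K', hK'n, hK'c, hg'⟩ :=
    exists_isMaxProSigmaQuotient ({l} : Set ℕ) (P := (U.map α.toMulEquiv.toMonoidHom : Subgroup P'))
  haveI := hKn
  haveI := hK'n
  haveI : TotallyDisconnectedSpace (U ⧸ K) :=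
    AbsoluteAnabelian.QuotientGroup.totallyDisconnectedSpace_of_isClosed K hKc
  haveI : TotallyDisconnectedSpace ((U.map α.toMulEquiv.toMonoidHom : Subgroup P') ⧸ K') :=
    AbsoluteAnabelian.QuotientGroup.totallyDisconnectedSpace_of_isClosed K' hK'c
  -- `ᾱ_U` over `α|_U`
  set αU : U ≃ₜ* (U.map α.toMulEquiv.toMonoidHom : Subgroup P') := restrictIso α rfl with hαUdef
  have hαU : ∀ u : U, ((αU u : (U.map α.toMulEquiv.toMonoidHom : Subgroup P')) : P') = α u :=
    fun u => rfl
  have hker : (QuotientGroup.mk' K).ker.map αU.toMulEquiv.toMonoidHom = (QuotientGroup.mk' K').ker :=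
    hg.map_ker_eq hg' αU
  obtain ⟨ᾱ, hᾱ⟩ := exists_over_of_ker_map_eq αU hg.continuous hg.surjective hg'.continuous
    hg'.surjective hker
  -- the shadows: of `Ω`-type, `Σ = {l}`, `ᾱ_U` graphically filtration-preserving
  have hSl : ({l} : Set ℕ) ⊆ G.Sigma := Set.singleton_subset_iff.mpr hl
  have hSl' : ({l} : Set ℕ) ⊆ H.Sigma := Set.singleton_subset_iff.mpr hl'
  have hne : ({l} : Set ℕ).Nonempty := Set.singleton_nonempty l
  have hDΩ := hmapΩ (G.restrictBD U hUo bd) {l} hSl hne (QuotientGroup.mk' K) hg (hbd U hUo)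
  have hD'Ω := hmapΩ (H.restrictBD _ hU'o bd') {l} hSl' hne (QuotientGroup.mk' K') hg' (hbd' _ hU'o)
  have hαUfp : (G.restrictBD U hUo bd).IsGraphicallyFiltrationPreserving
      (H.restrictBD (U.map α.toMulEquiv.toMonoidHom) hU'o bd') αU :=
    hα.restrictBD G H α hUo hU'o rfl bd bd'
  have hsh := hαUfp.mapAlong (G.restrictBD U hUo bd) (H.restrictBD _ hU'o bd') (QuotientGroup.mk' K)
    hg.continuous {l} hSl hne hg.proSigma (QuotientGroup.mk' K') hg'.continuous hSl' hg'.proSigma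
    hg.surjective hg'.surjective hker hᾱ
  -- the `Σ = {l}` case of Thm. 1.6 (ii), for the shadows
  have hgr := isGraphic_of_isGraphicallyFiltrationPreserving_holds' Ω hprof hrank hcuspΩ hnodal hcpt hres
    hcover hopen hCT hP15 hunr hrankv hconn hDΩ hD'Ω (mapAlong_Sigma _ _ _ _ _ _ _)
    (mapAlong_Sigma _ _ _ _ _ _ _) hsh
  obtain ⟨ι₀, hvia⟩ := hgr
  have hKn' : ((QuotientGroup.mk' K').ker.map (U.map α.toMulEquiv.toMonoidHom).subtype).Normal :=
    normal_map_subtype_ker_of_isMaxProSigmaQuotient hg'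
  exact ⟨vertex_package_of_isGraphicVia_shadow G H α U hUo bd _ hU'o bd' (QuotientGroup.mk' K)
      hg.continuous {l} hSl hg.proSigma (QuotientGroup.mk' K') hg'.continuous hg'.surjective hSl'
      hg'.proSigma rfl αU hαU ᾱ hᾱ hKn' hne ι₀ hvia (hopen _ hD'Ω).1,
    edge_package_of_isGraphicVia_shadow G H α U hUo bd _ hU'o bd' (QuotientGroup.mk' K)
      hg.continuous {l} hSl hg.proSigma (QuotientGroup.mk' K') hg'.continuous hg'.surjective hSl'
      hg'.proSigma rfl αU hαU ᾱ hᾱ hKn' hne ι₀ hvia (hopen _ hD'Ω).2.1⟩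

end Level

/-! ### Theorem 1.6 (ii) for general `Σ` -/

section Origin

variable (Ω : PSCOrigin.{u})

/-- **[CombGC] Theorem 1.6 (ii) ⇐ for GENERAL `Σ`** ("we may assume that `Σ = {l}`", p. 13): for `G`,
`H` of `Ω`-type on profinite groups with a common prime `l ∈ Σ_G ∩ Σ_H`, a graphically
filtration-preserving `α : Π_G ≅ Π_H` is GRAPHIC — from the `Σ = {l}` theorem applied to the pro-`l`
shadows of all covering levels (`shadow_packages_at_level`), abc-iut-w5-d188's descents to `α`, and
Prop. 1.5 (ii).  Inputs, all origin statements BY NAME: `RankStatementsHold`,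
`CuspidalEdgeLikeCharacterizationHolds`, `NodalEdgeLikeCharacterizationHolds`, `CompactifyOfPSCTypeHolds`,
`RestrictBDOfPSCTypeHolds`, `SturdyCoverHolds`, `OpenInterDeterminesComponentHolds`,
`CommensurableTerminalityHolds`, `GraphicIffEdgeLikeVerticialHolds`, `UnrVerticialCharacterizationHolds'`
(corrected F-1938 successor), `UnrVertAbOfRankHolds`, `VertCountLeNodeCountSuccHolds`,
`MapAlongProLOfPSCTypeHolds`; profiniteness `hprof`. [cite: MochizukiCombGC2007, Thm 1.6(ii) p.13] -/
theorem isGraphic_of_isGraphicallyFiltrationPreserving_generalSigma_holds'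
    (hprof : ∀ ⦃R : Type u⦄ [Group R] [TopologicalSpace R] [IsTopologicalGroup R] (K : PSCDatum R),
      Ω.IsOfPSCType K → CompactSpace R ∧ TotallyDisconnectedSpace R)
    (hrank : RankStatementsHold Ω) (hcuspΩ : CuspidalEdgeLikeCharacterizationHolds Ω)
    (hnodal : NodalEdgeLikeCharacterizationHolds Ω) (hcpt : CompactifyOfPSCTypeHolds Ω)
    (hres : RestrictBDOfPSCTypeHolds Ω) (hcover : SturdyCoverHolds Ω)
    (hopen : OpenInterDeterminesComponentHolds Ω) (hCT : CommensurableTerminalityHolds Ω)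
    (hP15 : GraphicIffEdgeLikeVerticialHolds Ω) (hunr : UnrVerticialCharacterizationHolds' Ω)
    (hrankv : UnrVertAbOfRankHolds Ω) (hconn : VertCountLeNodeCountSuccHolds Ω)
    (hmapΩ : MapAlongProLOfPSCTypeHolds Ω)
    ⦃P : Type u⦄ [Group P] [TopologicalSpace P] [IsTopologicalGroup P]
    ⦃P' : Type u⦄ [Group P'] [TopologicalSpace P'] [IsTopologicalGroup P']
    {G : PSCDatum P} {H : PSCDatum P'} {α : P ≃ₜ* P'} (hGΩ : Ω.IsOfPSCType G) (hHΩ : Ω.IsOfPSCType H)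
    {l : ℕ} (hl : l ∈ G.Sigma) (hl' : l ∈ H.Sigma) (hα : G.IsGraphicallyFiltrationPreserving H α) :
    G.IsGraphic H α := by
  obtain ⟨hcP, htP⟩ := hprof G hGΩ
  obtain ⟨hcP', htP'⟩ := hprof H hHΩ
  haveI := hcP; haveI := htP; haveI := hcP'; haveI := htP'
  obtain ⟨bd, hbd⟩ := hres G hGΩ
  obtain ⟨bd', hbd'⟩ := hres H hHΩ
  have hlev := fun (U : Subgroup P) (hUn : U.Normal) (hUo : IsOpen (U : Set P)) =>
    shadow_packages_at_level Ω hprof hrank hcuspΩ hnodal hcpt hres hcover hopen hCT hP15 hunr hrankv hconn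
      hmapΩ bd bd' hbd hbd' hl hl' hα U hUn hUo
  have hvert : G.IsGroupTheoreticallyVerticial H α :=
    isGroupTheoreticallyVerticial_of_graphic_mod α G H fun U hUn hUo => (hlev U hUn hUo).1
  have hedge : G.IsGroupTheoreticallyEdgeLike H α :=
    isGroupTheoreticallyEdgeLike_of_graphic_mod α G H fun U hUn hUo => (hlev U hUn hUo).2
  exact (hP15 G H α hGΩ hHΩ).1.mpr ⟨hedge, hvert⟩

/-- **[CombGC] Theorem 1.6 (ii) as typed (`GraphicIffGraphicallyFiltrationPreserving`), for GENERAL `Σ`**: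
for all data of `Ω`-type on profinite groups with a common prime `l ∈ Σ_G ∩ Σ_H` and every
`α : Π_G ⥲ Π_H`, "`α` is graphic if and only if it is graphically filtration-preserving" — necessity by
abc-iut-L5-t6's `isGraphicallyFiltrationPreserving_of_isGraphic`, sufficiency by shadow graphicity;
inputs BY NAME as above. [cite: MochizukiCombGC2007, Thm 1.6(ii) p.13] -/
theorem graphicIffFiltrationPreserving_generalSigma_holds_of_inputs'
    (hprof : ∀ ⦃R : Type u⦄ [Group R] [TopologicalSpace R] [IsTopologicalGroup R] (K : PSCDatum R),
      Ω.IsOfPSCType K → CompactSpace R ∧ TotallyDisconnectedSpace R)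
    (hrank : RankStatementsHold Ω) (hcuspΩ : CuspidalEdgeLikeCharacterizationHolds Ω)
    (hnodal : NodalEdgeLikeCharacterizationHolds Ω) (hcpt : CompactifyOfPSCTypeHolds Ω)
    (hres : RestrictBDOfPSCTypeHolds Ω) (hcover : SturdyCoverHolds Ω)
    (hopen : OpenInterDeterminesComponentHolds Ω) (hCT : CommensurableTerminalityHolds Ω)
    (hP15 : GraphicIffEdgeLikeVerticialHolds Ω) (hunr : UnrVerticialCharacterizationHolds' Ω)
    (hrankv : UnrVertAbOfRankHolds Ω) (hconn : VertCountLeNodeCountSuccHolds Ω)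
    (hmapΩ : MapAlongProLOfPSCTypeHolds Ω)
    ⦃P : Type u⦄ [Group P] [TopologicalSpace P] [IsTopologicalGroup P]
    ⦃P' : Type u⦄ [Group P'] [TopologicalSpace P'] [IsTopologicalGroup P']
    {G : PSCDatum P} {H : PSCDatum P'} (hGΩ : Ω.IsOfPSCType G) (hHΩ : Ω.IsOfPSCType H)
    {l : ℕ} (hl : l ∈ G.Sigma) (hl' : l ∈ H.Sigma) (α : P ≃ₜ* P') :
    G.GraphicIffGraphicallyFiltrationPreserving H α :=
  ⟨G.isGraphicallyFiltrationPreserving_of_isGraphic H α,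
    isGraphic_of_isGraphicallyFiltrationPreserving_generalSigma_holds' Ω hprof hrank hcuspΩ hnodal hcpt
      hres hcover hopen hCT hP15 hunr hrankv hconn hmapΩ hGΩ hHΩ hl hl'⟩

end Origin


/-! ### [CombGC] Theorem 1.6 (ii) AS TYPED over the origin (`GraphicIffFiltrationPreservingHolds Ω`, every `Σ`) — appended -/

section HoldsAllSigma

variable (Ω : PSCOrigin.{u})

/-- **[CombGC] Theorem 1.6 (ii) as printed, `GraphicIffFiltrationPreservingHolds Ω` (abc-iut-L3-t4's typed
row F-0444), for EVERY `Σ`** — the common prime of `Σ_G`, `Σ_H` being automatic for nontrivial profinite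
`Π_G ≅ Π_H` (abc-iut-w5-d183's `exists_mem_sigma_inter_of_continuousMulEquiv`): granting, for all data of
`Ω`-type, profiniteness (`hprof`) and nontriviality (`hnt`; both hold for the pro-`Σ` fundamental group of a
pointed stable curve, displayed inline like `hprof`) of the PSC-fundamental groups, the twelve origin
statements of the `Σ = {l}` assembly (with the corrected [IUTchI] Rmk. 1.2.3 (iv) input
`UnrVerticialCharacterizationHolds'`) and `MapAlongProLOfPSCTypeHolds`: "`α` is graphic if and only if
it is graphically filtration-preserving" for ALL `G`, `H` of `Ω`-type and every `α : Π_G ⥲ Π_H`.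
(At a datum with trivial `Π` the statement is not formal — graphicity needs an isomorphism of the
underlying semi-graphs — whence the displayed `hnt`.) [cite: MochizukiCombGC2007, Thm 1.6(ii) p.13] -/
theorem graphicIffFiltrationPreservingHolds_of_inputs'
    (hprof : ∀ ⦃R : Type u⦄ [Group R] [TopologicalSpace R] [IsTopologicalGroup R] (K : PSCDatum R),
      Ω.IsOfPSCType K → CompactSpace R ∧ TotallyDisconnectedSpace R)
    (hnt : ∀ ⦃R : Type u⦄ [Group R] [TopologicalSpace R] [IsTopologicalGroup R] (K : PSCDatum R),
      Ω.IsOfPSCType K → Nontrivial R)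
    (hrank : RankStatementsHold Ω) (hcuspΩ : CuspidalEdgeLikeCharacterizationHolds Ω)
    (hnodal : NodalEdgeLikeCharacterizationHolds Ω) (hcpt : CompactifyOfPSCTypeHolds Ω)
    (hres : RestrictBDOfPSCTypeHolds Ω) (hcover : SturdyCoverHolds Ω)
    (hopen : OpenInterDeterminesComponentHolds Ω) (hCT : CommensurableTerminalityHolds Ω)
    (hP15 : GraphicIffEdgeLikeVerticialHolds Ω) (hunr : UnrVerticialCharacterizationHolds' Ω)
    (hrankv : UnrVertAbOfRankHolds Ω) (hconn : VertCountLeNodeCountSuccHolds Ω)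
    (hmapΩ : MapAlongProLOfPSCTypeHolds Ω) :
    Literature.AnabelianGeometry.SemiGraphs.PSCDatum.GraphicIffFiltrationPreservingHolds Ω := by
  intro Q _ _ _ Q' _ _ _ G H α hGΩ hHΩ
  obtain ⟨hcQ, htQ⟩ := hprof G hGΩ
  haveI := hcQ; haveI := htQ; haveI := hnt G hGΩ
  obtain ⟨l, hl, hl'⟩ := G.exists_mem_sigma_inter_of_continuousMulEquiv H α
  exact graphicIffFiltrationPreserving_generalSigma_holds_of_inputs' Ω hprof hrank hcuspΩ hnodal hcpt
    hres hcover hopen hCT hP15 hunr hrankv hconn hmapΩ hGΩ hHΩ hl hl' α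

end HoldsAllSigma


/-! ### The typed row F-0444 with NO displayed nontriviality (appended): the trivial-group datum via abc-iut-w5-d183's adapter -/

section HoldsAllSigmaNoNt

variable (Ω : PSCOrigin.{u})

/-- **[CombGC] Theorem 1.6 (ii) as printed, `GraphicIffFiltrationPreservingHolds Ω`, for EVERY `Σ` and
WITHOUT the displayed nontriviality of `Π`**: abc-iut-w5-d183's Ω-adapter
`graphicIffFiltrationPreserving_holds_of_commonPrimeVersion` (`PSCCommonPrimeGraphicProofs.lean`) settles
the degenerate datum on the trivial group from the rank statements already granted (one vertex, no
edges on both sides, so every `α` is graphic) and supplies the common prime otherwise; the common-prime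
case is `graphicIffFiltrationPreserving_generalSigma_holds_of_inputs'`.  Inputs: displayed profiniteness
and the thirteen origin statements BY NAME. [cite: MochizukiCombGC2007, Thm 1.6(ii) p.13] -/
theorem graphicIffFiltrationPreservingHolds_of_inputs''
    (hprof : ∀ ⦃R : Type u⦄ [Group R] [TopologicalSpace R] [IsTopologicalGroup R] (K : PSCDatum R),
      Ω.IsOfPSCType K → CompactSpace R ∧ TotallyDisconnectedSpace R)
    (hrank : RankStatementsHold Ω) (hcuspΩ : CuspidalEdgeLikeCharacterizationHolds Ω)
    (hnodal : NodalEdgeLikeCharacterizationHolds Ω) (hcpt : CompactifyOfPSCTypeHolds Ω)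
    (hres : RestrictBDOfPSCTypeHolds Ω) (hcover : SturdyCoverHolds Ω)
    (hopen : OpenInterDeterminesComponentHolds Ω) (hCT : CommensurableTerminalityHolds Ω)
    (hP15 : GraphicIffEdgeLikeVerticialHolds Ω) (hunr : UnrVerticialCharacterizationHolds' Ω)
    (hrankv : UnrVertAbOfRankHolds Ω) (hconn : VertCountLeNodeCountSuccHolds Ω)
    (hmapΩ : MapAlongProLOfPSCTypeHolds Ω) :
    Literature.AnabelianGeometry.SemiGraphs.PSCDatum.GraphicIffFiltrationPreservingHolds Ω := by
  refine graphicIffFiltrationPreserving_holds_of_commonPrimeVersion Ω hprof hrank hconn hopen ?_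
  intro Q _ _ _ Q' _ _ _ G H α hGΩ hHΩ hl
  obtain ⟨l, hl, hl'⟩ := hl
  exact graphicIffFiltrationPreserving_generalSigma_holds_of_inputs' Ω hprof hrank hcuspΩ hnodal hcpt
    hres hcover hopen hCT hP15 hunr hrankv hconn hmapΩ hGΩ hHΩ hl hl' α

end HoldsAllSigmaNoNt

end PSCDatum

end Literature.AnabelianGeometry.SemiGraphs

end
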